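import Mathlib
import HarnessLib
import Literature.Analysis.FluidPDE.ClassicalSolution
import Literature.Analysis.FluidPDE.LerayHopf
import Literature.Analysis.FluidPDE.SuitableWeak
import Literature.Analysis.FluidPDE.TypeIAncientMild

/-!
# Route `TypeIQuarterGate` — objects posited by LINE `scar_zoom` of crux `ScarEnvelopeTypeI`
  (item stmt-NavierStokesRegularity-23843): crux hypotheses, envelope, tameness, violators, twin-scar object

Definitions ONLY — the six propositions of the registered skeleton
`Cruxes/ScarEnvelopeTypeI/Lines/scar_zoom.lean` (line owner ns-idea-7 g0, skeleton sha16
`c570de7ba4c3`, critic idea-crit-7 PASS-WITH-PRICE 2026-08-28T03:14:42Z), copied VERBATIM (with the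
line's local notation `E3` spelled out as `EuclideanSpace ℝ (Fin 3)`) into an importable module in
the line's own namespace, so that the registered stubs

* `stub_blowupIsCompact      : CruxHypotheses ν T u p → TameOutside T u`,
* `stub_violatorsApproachScar : CruxHypotheses ν T u p → TameOutside T u → ¬ Envelope T u → ScarViolators T u`,
* `stub_scarZoom              : CruxHypotheses ν T u p → ScarViolators T u → ∃ M v, TwinScarObject M v`,
* `stub_noCascadeSplitting    : ∀ M v, ¬ TwinScarObject M v`

can be proved in separate `Theorems/` files against ONE tree declaration each and the skeleton can
import them by name (precedents: `CompletionRelayChainDefs`, `TaylorModelRungThreeDefs`).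

* `CruxHypotheses ν T u p` — the hypotheses of the crux `TypeIQuarterGate.ScarEnvelopeTypeI` bundled:
  `0 < ν`, `0 < T`, maximal smooth solution on `[0,T)`, Leray–Hopf on `[0,T]`, rapidly decaying datum,
  sup-norm Type-I rate at `T`, finitely many scars;
* `Envelope T u` — the conclusion of the crux: `‖u t x‖ ≤ C' + Σ_{a ∈ σ} C'/(‖x − a‖ + √(T − t))` on `[0,T)`;
* `TameOutside T u` — boundedness on an early slab `[0, T−δ] × ℝ³` and on the far field
  `[T−δ, T) × {R ≤ ‖x‖}`;
* `ScarViolators T u` — a sequence `(x_k, t_k) → (a, T)`, `x_k ≠ a`, parabolically far from `a`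
  (`(T − t_k)/‖x_k − a‖² → 0`) with `‖x_k − a‖ · ‖u (t_k) (x_k)‖ → ∞`;
* `SingularAt v a` — `v` unbounded on every backward parabolic neighbourhood `B_r(a) × (−r², 0)`;
* `TwinScarObject M v` — a Type-I ancient mild solution (tree class `IsTypeIAncientMild M v`) with
  uniformly locally bounded energy up to the final time, singular at time `0` at the origin and at a
  point of the unit sphere.

HONEST FRAMING: nothing is asserted here (definitions only); the crux `ScarEnvelopeTypeI`, its parent
`QuarterLawTypeI` and the summit are OPEN; no statement about them is proved by this file.
-/

noncomputable section

-- the summit-side namespace `Summit.NavierStokesRegularity.NavierStokesRegularity.…` (single-conjunct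
-- summit, D-0017) repeats a component by design; the dupNamespace linter would flag every declaration.
set_option linter.dupNamespace false

namespace Summit.NavierStokesRegularity.NavierStokesRegularity.Cruxes.ScarEnvelopeTypeI.ScarZoom

open MeasureTheory

/-- The hypotheses of the crux `TypeIQuarterGate.ScarEnvelopeTypeI`, bundled: a maximal smooth
Leray–Hopf solution on `[0,T)` from a rapidly decaying datum, with sup-norm Type-I blow-up at `T`
(`IsTypeIBlowup`: `‖u t x‖ ≤ C/√(T−t)` for all `x` and all `t < T` close to `T`) and finitely many
scars (off a finite set every point carries a bounded backward parabolic neighbourhood).  Verbatim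
from the skeleton `Cruxes/ScarEnvelopeTypeI/Lines/scar_zoom.lean`. -/
def CruxHypotheses (ν T : ℝ)
    (u : ℝ → EuclideanSpace ℝ (Fin 3) → EuclideanSpace ℝ (Fin 3))
    (p : ℝ → EuclideanSpace ℝ (Fin 3) → ℝ) : Prop :=
  0 < ν ∧ 0 < T ∧ Literature.Analysis.FluidPDE.IsMaximalSmoothSolution ν 0 u p T ∧
    Literature.Analysis.FluidPDE.IsLerayHopfOn T ν 0 (u 0) u ∧
    Literature.Analysis.FluidPDE.HasRapidSpatialDecay (u 0) ∧
    Literature.Analysis.FluidPDE.IsTypeIBlowup u T ∧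
    ∃ σ : Finset (EuclideanSpace ℝ (Fin 3)), ∀ x ∉ σ, ∃ r : ℝ, 0 < r ∧ ∃ A : ℝ,
      ∀ t ∈ Set.Ico (T - r ^ 2) T, ∀ y ∈ Metric.ball x r, ‖u t y‖ ≤ A

/-- The conclusion of the crux: the multi-scar Type-I space–time ENVELOPE on `[0,T)`,
`‖u t x‖ ≤ C' + Σ_{a ∈ σ} C'/(‖x − a‖ + √(T − t))` for some finite `σ` and some `C'`.  Verbatim from
the skeleton. -/
def Envelope (T : ℝ) (u : ℝ → EuclideanSpace ℝ (Fin 3) → EuclideanSpace ℝ (Fin 3)) : Prop :=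
  ∃ (σ : Finset (EuclideanSpace ℝ (Fin 3))) (C' : ℝ), ∀ t ∈ Set.Ico 0 T,
    ∀ x : EuclideanSpace ℝ (Fin 3),
      ‖u t x‖ ≤ C' + ∑ a ∈ σ, C' / (‖x - a‖ + Real.sqrt (T - t))

/-- TAMENESS OUTSIDE THE BLOW-UP REGION: for some `δ > 0`, `R`, `B`, the solution is bounded by `B`
on the early slab `[0, T−δ] × ℝ³` and on the far field `[T−δ, T) × {R ≤ ‖x‖}` — the blow-up at the
maximal time `T` is spatially compact and no earlier time is singular (true under the crux
hypotheses by far-field ε-regularity from the decaying datum plus joint continuity; it is the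
registered infrastructure stub `stub_blowupIsCompact`).  Junk corner: `δ ≥ T` makes the first clause
speak about `Icc 0 (T−δ)` with `T − δ ≤ 0` (vacuous or `t = 0` only); harmless for its users.
Verbatim from the skeleton. -/
def TameOutside (T : ℝ) (u : ℝ → EuclideanSpace ℝ (Fin 3) → EuclideanSpace ℝ (Fin 3)) : Prop :=
  ∃ δ R B : ℝ, 0 < δ ∧ (∀ t ∈ Set.Icc 0 (T - δ), ∀ x : EuclideanSpace ℝ (Fin 3), ‖u t x‖ ≤ B) ∧
    ∀ t ∈ Set.Ico (T - δ) T, ∀ x : EuclideanSpace ℝ (Fin 3), R ≤ ‖x‖ → ‖u t x‖ ≤ B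

/-- ENVELOPE VIOLATORS at a point `a`: a sequence `(x_k, t_k) → (a, T)` in `[0,T) × (ℝ³ ∖ {a})`,
parabolically far from the scar (`(T − t_k)/‖x_k − a‖² → 0`), along which
`‖x_k − a‖ · ‖u (t_k) (x_k)‖ → ∞`.  Verbatim from the skeleton. -/
def ScarViolators (T : ℝ) (u : ℝ → EuclideanSpace ℝ (Fin 3) → EuclideanSpace ℝ (Fin 3)) : Prop :=
  ∃ (a : EuclideanSpace ℝ (Fin 3)) (x : ℕ → EuclideanSpace ℝ (Fin 3)) (t : ℕ → ℝ),
    (∀ k, t k ∈ Set.Ico 0 T) ∧ (∀ k, x k ≠ a) ∧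
    Filter.Tendsto t Filter.atTop (nhds T) ∧ Filter.Tendsto x Filter.atTop (nhds a) ∧
    Filter.Tendsto (fun k => (T - t k) / ‖x k - a‖ ^ 2) Filter.atTop (nhds 0) ∧
    Filter.Tendsto (fun k => ‖x k - a‖ * ‖u (t k) (x k)‖) Filter.atTop Filter.atTop

/-- `v` is SINGULAR at the space–time point `(a, 0)`: unbounded on every backward parabolic
neighbourhood `B_r(a) × (−r², 0)`, `r > 0`.  Verbatim from the skeleton. -/
def SingularAt (v : ℝ → EuclideanSpace ℝ (Fin 3) → EuclideanSpace ℝ (Fin 3))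
    (a : EuclideanSpace ℝ (Fin 3)) : Prop :=
  ∀ r : ℝ, 0 < r → ∀ A : ℝ, ∃ t ∈ Set.Ioo (-(r ^ 2)) 0, ∃ y ∈ Metric.ball a r, A < ‖v t y‖

/-- A TWIN-SCAR OBJECT with Type-I constant `M`: a Type-I ancient mild solution in the KNSS/Oseen
gauge (`Literature.Analysis.FluidPDE.IsTypeIAncientMild M v`: jointly smooth on the open past,
divergence-free, Oseen-mild between negative times, `‖v t x‖ ≤ M/√(−t)`), uniformly locally
square-integrable up to the final time (Seregin's scaled energy), singular at time `0` both at the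
origin and at some point of the unit sphere.  The deciding stub of the line says no such object
exists; the rung `M < 1` is proved in the skeleton from the tree's small-constant Liouville theorem.
Verbatim from the skeleton. -/
def TwinScarObject (M : ℝ) (v : ℝ → EuclideanSpace ℝ (Fin 3) → EuclideanSpace ℝ (Fin 3)) : Prop :=
  Literature.Analysis.FluidPDE.IsTypeIAncientMild M v ∧
    (∃ E : ℝ, ∀ x₀ : EuclideanSpace ℝ (Fin 3), ∀ t ∈ Set.Ioo (-1 : ℝ) 0,
      ∫⁻ y in Metric.ball x₀ 1, ENNReal.ofReal (‖v t y‖ ^ 2) ≤ ENNReal.ofReal E) ∧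
    SingularAt v 0 ∧
    ∃ e : EuclideanSpace ℝ (Fin 3), ‖e‖ = 1 ∧ SingularAt v e

end Summit.NavierStokesRegularity.NavierStokesRegularity.Cruxes.ScarEnvelopeTypeI.ScarZoom

end
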